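import Summits.AnomalousDissipation.AnomalousDissipation.Theses.WazewskiBlock
import Summits.AnomalousDissipation.AnomalousDissipation.Theorems.WazewskiBlockUniformWorkFloorTrapLerayHopf
import Summits.AnomalousDissipation.AnomalousDissipation.Theorems.WazewskiBlockUniformWorkFloorTrapLoadBearing
import Literature.Analysis.FluidPDE.NSGalerkinTrajectory

/-!
# Route `WazewskiBlock`, crux `UniformGalerkinTrap` (stmt-AnomalousDissipation-10352):
# the SEAM SPLIT — rank 2 = rank 3 (cap-free trap, stmt-10353) + a fixed-viscosity cap upgrade

Definition-free support file (crux-strategist p1, 2026-08-17; landed verbatim from the crux workfile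
`Cruxes/UniformGalerkinTrap/StrategistSeamSplitP1.lean` by line lead c4, `--supports` stmt-10352, so that
the planner's prepared `route edit --split UniformGalerkinTrap … --glue-by UniformGalerkinTrap_of_subs`
can cite a landed glue).  The rank-2 crux `UniformGalerkinTrap`
asks, for every small viscosity `ν` and every Galerkin order `N ≥ N₀(ν)`, for ONE global Galerkin
trajectory trapped for all `t ≥ 0` in `{kineticEnergy ≤ E} ∩ {(f,·) ≥ ε₀} ∩ {eGradNormSq ≤ G(ν)}`.
Four leads and five triagers found every Galerkin-level mechanism for it dead or crux-sized and
recommended cutting the crux ALONG ITS SEAM (crux notes `NegativeNotesIdeator5.md` §4(i),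
`TRIAGE-r1-3.md`, `Lines/SketchIdeator4Dead.md` §3): the `ν → 0` content is exactly the cap-free
sibling crux `UniformWorkFloorTrap` (stmt-10353), and what the cap adds is a FIXED-viscosity,
`N`-uniform regularity statement with no `ν → 0` content.  Kernel-checked here:

* `UniformGalerkinTrap_of_subs` — **the glue of the split**
  `UniformWorkFloorTrap → LoudOrbitsEventuallyCapped → UniformGalerkinTrap`, where the second
  hypothesis (stated verbatim, in the route's clause-block vocabulary) says: at every fixed `ν > 0`,
  for every mean-zero Galerkin-mode force and every `E`, `ε₀ > 0`, there are a cap `G` and an order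
  `N₁` such that EVERY global Galerkin trajectory of order `N ≥ N₁` that keeps `kineticEnergy ≤ E`
  and `(f, U t) ≥ ε₀` for all `t ≥ 0` satisfies `eGradNormSq (U t) ≤ G` from some time `τ` on
  (an `N`-uniform eventual enstrophy cap — the absorbing-ball-in-`V` property of 2-D Navier–Stokes,
  restricted to loud energy-bounded Galerkin trajectories; open in 3-D, regularity-class).
  Proof: the Galerkin system with a steady force is autonomous, so the time shift `t ↦ U (t + τ)`
  of a trapped trajectory is again a trapped trajectory (`Torus.IsGalerkinTrajectory.comp_add_right`),
  now capped from `t = 0`.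
* `capUpgrade_of_uniformGalerkinTrap` — conversely the rank-2 crux gives the ∃-form of the upgrade
  (same force and window: some loud bounded trajectory is capped from `t = 0` at every large order),
  so together with the landed `uniformWorkFloorTrap_of_uniformGalerkinTrap` the seam is exact:
  `UniformGalerkinTrap ↔ UniformWorkFloorTrap ∧ (∃-cap upgrade for the same witness data)`
  (`uniformGalerkinTrap_iff_workFloorTrap_and_capUpgrade`).

References: Constantin–Foias 1988, Ch. 8 (8.3)–(8.7) (autonomous Galerkin system);
Robinson–Rodrigo–Sadowski 2016, Thm. 4.4 Steps 1–2; Constantin–Foias–Temam 1985, Mem. AMS 53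
no. 314, §3 (the standing assumption `sup_t ‖∇u‖ < ∞` under which 3-D attractor theory runs);
Doering–Gibbon 1995, Ch. 7 (the 2-D absorbing ball in `V`).
-/

noncomputable section

-- `Summit.<Summit>.<Problem>` is the tree's mandated summit-side namespace (CONVENTIONS §2); deliberate duplicate.
set_option linter.dupNamespace false

namespace Summit.AnomalousDissipation.AnomalousDissipation.Theorems.UniformGalerkinTrap

open scoped InnerProductSpace RealInnerProductSpace ENNReal NNReal
open MeasureTheory Filter Set UnitAddTorus
open Literature.Analysis.FunctionSpaces Literature.Analysis.FunctionSpaces.Torus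
open Literature.Analysis.FluidPDE
open Summit.AnomalousDissipation.AnomalousDissipation.Theses.WazewskiBlock
  (UniformWorkFloorTrap UniformGalerkinTrap)
open Summit.AnomalousDissipation.AnomalousDissipation.Theorems.UniformWorkFloorTrap
  (uniformWorkFloorTrap_of_uniformGalerkinTrap dissipation_floor_of_trapped)

/-! ## §1 The seam glue: cap-free trap + fixed-`ν` eventual cap ⇒ the rank-2 crux -/

/-- **Seam split of the rank-2 crux** (`UniformWorkFloorTrap → LoudOrbitsEventuallyCapped →
UniformGalerkinTrap`).  Hypothesis `h₂` is the sub-crux `LoudOrbitsEventuallyCapped` verbatim: at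
every FIXED viscosity `ν > 0`, for every mean-zero Galerkin-mode force `f` and all `E`, `ε₀ > 0`
there are `G`, `N₁` such that every global Galerkin trajectory of order `N ≥ N₁` (the route's
clause block) trapped for all `t ≥ 0` in `{kineticEnergy ≤ E} ∩ {(f,·) ≥ ε₀}` has
`eGradNormSq (U t) ≤ G` for all `t ≥ τ`, some `τ ≥ 0`.  Proof: take the cap-free trapped
trajectory of `UniformWorkFloorTrap` at order `N ≥ max N₀ N₁`, its cap time `τ`, and shift time
by `τ` (`Torus.IsGalerkinTrajectory.comp_add_right`: the Galerkin system with a steady force is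
autonomous). [cite: ConstantinFoias1988, Ch. 8 (8.3)–(8.7)] -/
theorem UniformGalerkinTrap_of_subs (h₁ : UniformWorkFloorTrap)
    (h₂ : ∀ ν : ℝ, 0 < ν → ∀ (m : ℕ) (f : UnitAddTorus (Fin 3) → EuclideanSpace ℝ (Fin 3)),
      (IsSmooth f ∧ IsDivFree f ∧ ∀ k : Fin 3 → ℤ, ((m : ℕ) : ℝ) ^ 2 < freqNormSq k →
        mFourierCoeff (EuclideanSpace.complexify ∘ f) k = 0) → HasZeroMean f →
      ∀ E ε₀ : ℝ, 0 < ε₀ → ∃ (G : ℝ≥0) (N₁ : ℕ), ∀ N : ℕ, N₁ ≤ N →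
        ∀ U : ℝ → UnitAddTorus (Fin 3) → EuclideanSpace ℝ (Fin 3),
          (ContinuousOn (stLift U) (Ici 0 ×ˢ univ) ∧
            (∀ t : ℝ, 0 ≤ t → (IsSmooth (U t) ∧ IsDivFree (U t) ∧ ∀ k : Fin 3 → ℤ,
              ((N : ℕ) : ℝ) ^ 2 < freqNormSq k → mFourierCoeff (EuclideanSpace.complexify ∘ (U t)) k = 0) ∧
              IsWeaklyDivFree (U t)) ∧
            (∀ a : UnitAddTorus (Fin 3) → EuclideanSpace ℝ (Fin 3),
              (IsSmooth a ∧ IsDivFree a ∧ ∀ k : Fin 3 → ℤ, ((N : ℕ) : ℝ) ^ 2 < freqNormSq k →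
                mFourierCoeff (EuclideanSpace.complexify ∘ a) k = 0) →
              ∀ s t : ℝ, 0 ≤ s → s ≤ t →
                (∫ x, ⟪U t x, a x⟫_ℝ) - ∫ x, ⟪U s x, a x⟫_ℝ =
                  ∫ τ in s..t, ∫ x, (⟪U τ x, convect (U τ) a x⟫_ℝ + ν * ⟪U τ x, laplacian a x⟫_ℝ +
                    ⟪f x, a x⟫_ℝ)) ∧
            (∀ s t : ℝ, 0 ≤ s → s ≤ t →
              kineticEnergy (U t) + ν * (∫⁻ τ in Ioo s t, eGradNormSq (U τ)).toReal =
                kineticEnergy (U s) + ∫ τ in s..t, ∫ x, ⟪f x, U τ x⟫_ℝ)) →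
          (∀ t : ℝ, 0 ≤ t → kineticEnergy (U t) ≤ E ∧ ε₀ ≤ ∫ x, ⟪f x, U t x⟫_ℝ) →
          ∃ τ : ℝ, 0 ≤ τ ∧ ∀ t : ℝ, τ ≤ t → eGradNormSq (U t) ≤ (G : ℝ≥0∞)) :
    UniformGalerkinTrap := by
  obtain ⟨m, f, hf, hmean, E, ε₀, ν₀, hε₀, hν₀, h⟩ := h₁
  refine ⟨m, f, hf, hmean, E, ε₀, ν₀, hε₀, hν₀, fun ν hν hνle => ?_⟩
  obtain ⟨N₀, hN⟩ := h ν hν hνle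
  obtain ⟨G, N₁, hcap⟩ := h₂ ν hν m f hf hmean E ε₀ hε₀
  refine ⟨G, max N₀ N₁, fun N hNle => ?_⟩
  obtain ⟨U, hcl, htrap⟩ := hN N (le_of_max_le_left hNle)
  obtain ⟨τ, hτ, hZ⟩ := hcap N (le_of_max_le_right hNle) U hcl htrap
  -- the clause block is `Torus.IsGalerkinTrajectory`, invariant under the time shift `t ↦ t + τ`
  have htraj : Torus.IsGalerkinTrajectory ν f N U := Torus.isGalerkinTrajectory_iff.2 hcl
  have hshift : Torus.IsGalerkinTrajectory ν f N (fun t => U (t + τ)) := htraj.comp_add_right hτ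
  refine ⟨fun t => U (t + τ), Torus.isGalerkinTrajectory_iff.1 hshift, fun t ht => ?_⟩
  have htτ : 0 ≤ t + τ := add_nonneg ht hτ
  exact ⟨(htrap (t + τ) htτ).1, (htrap (t + τ) htτ).2, hZ (t + τ) (le_add_of_nonneg_left ht)⟩

/-! ## §2 The seam is exact: the rank-2 crux gives back the ∃-form of the cap upgrade -/

/-- **The rank-2 crux ⇒ the ∃-form of the cap upgrade for its own witness data**: with the crux's
`(m, f, E, ε₀, ν₀)`, for every `0 < ν ≤ ν₀` there are `G`, `N₀` such that every order `N ≥ N₀`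
carries a global Galerkin trajectory trapped in the cap-free block AND capped from `t = 0`
(read off the crux; recorded so that the seam `rank 2 = rank 3 + cap upgrade` is an equivalence
for the witness data, `uniformGalerkinTrap_iff_workFloorTrap_and_capUpgrade`). [folklore] -/
theorem capUpgrade_of_uniformGalerkinTrap (h : UniformGalerkinTrap) :
    ∃ (m : ℕ) (f : UnitAddTorus (Fin 3) → EuclideanSpace ℝ (Fin 3)),
      (IsSmooth f ∧ IsDivFree f ∧ ∀ k : Fin 3 → ℤ, ((m : ℕ) : ℝ) ^ 2 < freqNormSq k →
        mFourierCoeff (EuclideanSpace.complexify ∘ f) k = 0) ∧ HasZeroMean f ∧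
      ∃ (E ε₀ ν₀ : ℝ), 0 < ε₀ ∧ 0 < ν₀ ∧ ∀ ν : ℝ, 0 < ν → ν ≤ ν₀ → ∃ (G : ℝ≥0) (N₀ : ℕ),
        ∀ N : ℕ, N₀ ≤ N → ∃ U : ℝ → UnitAddTorus (Fin 3) → EuclideanSpace ℝ (Fin 3),
          Torus.IsGalerkinTrajectory ν f N U ∧
            (∀ t : ℝ, 0 ≤ t → kineticEnergy (U t) ≤ E ∧ ε₀ ≤ ∫ x, ⟪f x, U t x⟫_ℝ) ∧
            ∀ t : ℝ, 0 ≤ t → eGradNormSq (U t) ≤ (G : ℝ≥0∞) := by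
  obtain ⟨m, f, hf, hmean, E, ε₀, ν₀, hε₀, hν₀, h⟩ := h
  refine ⟨m, f, hf, hmean, E, ε₀, ν₀, hε₀, hν₀, fun ν hν hνle => ?_⟩
  obtain ⟨G, N₀, hN⟩ := h ν hν hνle
  refine ⟨G, N₀, fun N hN₀ => ?_⟩
  obtain ⟨U, hcl, htrap⟩ := hN N hN₀
  exact ⟨U, Torus.isGalerkinTrajectory_iff.2 hcl, fun t ht => ⟨(htrap t ht).1, (htrap t ht).2.1⟩,
    fun t ht => (htrap t ht).2.2⟩

/-- **The seam is exact for the witness data.**  `UniformGalerkinTrap` holds iff there are a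
mean-zero Galerkin-mode force and `E, ε₀, ν₀ > 0` witnessing BOTH the cap-free trap (the body of
`UniformWorkFloorTrap`, in `Torus.IsGalerkinTrajectory` form) AND, for the same data, the cap
upgrade (some trapped trajectory of every large order is enstrophy-capped from `t = 0`).  The two
conjuncts are the `ν → 0` content (rank 3) and the fixed-`ν` regularity content of rank 2. [folklore] -/
theorem uniformGalerkinTrap_iff_workFloorTrap_and_capUpgrade :
    UniformGalerkinTrap ↔
      ∃ (m : ℕ) (f : UnitAddTorus (Fin 3) → EuclideanSpace ℝ (Fin 3)),
        (IsSmooth f ∧ IsDivFree f ∧ ∀ k : Fin 3 → ℤ, ((m : ℕ) : ℝ) ^ 2 < freqNormSq k →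
          mFourierCoeff (EuclideanSpace.complexify ∘ f) k = 0) ∧ HasZeroMean f ∧
        ∃ (E ε₀ ν₀ : ℝ), 0 < ε₀ ∧ 0 < ν₀ ∧
          (∀ ν : ℝ, 0 < ν → ν ≤ ν₀ → ∃ N₀ : ℕ, ∀ N : ℕ, N₀ ≤ N →
            ∃ U : ℝ → UnitAddTorus (Fin 3) → EuclideanSpace ℝ (Fin 3),
              Torus.IsGalerkinTrajectory ν f N U ∧
                ∀ t : ℝ, 0 ≤ t → kineticEnergy (U t) ≤ E ∧ ε₀ ≤ ∫ x, ⟪f x, U t x⟫_ℝ) ∧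
          (∀ ν : ℝ, 0 < ν → ν ≤ ν₀ → ∃ (G : ℝ≥0) (N₁ : ℕ), ∀ N : ℕ, N₁ ≤ N →
            (∃ U : ℝ → UnitAddTorus (Fin 3) → EuclideanSpace ℝ (Fin 3),
              Torus.IsGalerkinTrajectory ν f N U ∧
                ∀ t : ℝ, 0 ≤ t → kineticEnergy (U t) ≤ E ∧ ε₀ ≤ ∫ x, ⟪f x, U t x⟫_ℝ) →
            ∃ U : ℝ → UnitAddTorus (Fin 3) → EuclideanSpace ℝ (Fin 3),
              Torus.IsGalerkinTrajectory ν f N U ∧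
                (∀ t : ℝ, 0 ≤ t → kineticEnergy (U t) ≤ E ∧ ε₀ ≤ ∫ x, ⟪f x, U t x⟫_ℝ) ∧
                ∃ τ : ℝ, 0 ≤ τ ∧ ∀ t : ℝ, τ ≤ t → eGradNormSq (U t) ≤ (G : ℝ≥0∞)) := by
  constructor
  · intro h
    obtain ⟨m, f, hf, hmean, E, ε₀, ν₀, hε₀, hν₀, h⟩ := capUpgrade_of_uniformGalerkinTrap h
    refine ⟨m, f, hf, hmean, E, ε₀, ν₀, hε₀, hν₀, fun ν hν hνle => ?_, fun ν hν hνle => ?_⟩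
    · obtain ⟨G, N₀, hN⟩ := h ν hν hνle
      refine ⟨N₀, fun N hN₀ => ?_⟩
      obtain ⟨U, hU, htrap, -⟩ := hN N hN₀
      exact ⟨U, hU, htrap⟩
    · obtain ⟨G, N₀, hN⟩ := h ν hν hνle
      refine ⟨G, N₀, fun N hN₀ _ => ?_⟩
      obtain ⟨U, hU, htrap, hZ⟩ := hN N hN₀
      exact ⟨U, hU, htrap, 0, le_rfl, fun t ht => hZ t ht⟩
  · rintro ⟨m, f, hf, hmean, E, ε₀, ν₀, hε₀, hν₀, h53, hcap⟩
    refine ⟨m, f, hf, hmean, E, ε₀, ν₀, hε₀, hν₀, fun ν hν hνle => ?_⟩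
    obtain ⟨N₀, hN⟩ := h53 ν hν hνle
    obtain ⟨G, N₁, hG⟩ := hcap ν hν hνle
    refine ⟨G, max N₀ N₁, fun N hNle => ?_⟩
    obtain ⟨U, hU, htrap, τ, hτ, hZ⟩ :=
      hG N (le_of_max_le_right hNle) (hN N (le_of_max_le_left hNle))
    have hshift : Torus.IsGalerkinTrajectory ν f N (fun t => U (t + τ)) := hU.comp_add_right hτ
    refine ⟨fun t => U (t + τ), Torus.isGalerkinTrajectory_iff.1 hshift, fun t ht => ?_⟩
    have htτ : 0 ≤ t + τ := add_nonneg ht hτ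
    exact ⟨(htrap (t + τ) htτ).1, (htrap (t + τ) htτ).2, hZ (t + τ) (le_add_of_nonneg_left ht)⟩

/-! ## §3 Tightness of the seam: the cap of rank 2 is necessarily `ν`-singular -/

/-- **Refuted strengthening (tightness lemma): a `ν`-UNIFORM enstrophy cap is impossible.**  For
EVERY force: the rank-2 crux with `∃ G ∀ ν ≤ ν₀` in place of `∀ ν ≤ ν₀ ∃ G` is FALSE — a trajectory
trapped at viscosity `ν` with `eGradNormSq ≤ G` dissipates at most `ν G` per unit time, while the
work floor forces mean dissipation `≥ ε₀ − E/T` (`dissipation_floor_of_trapped`); for `ν G ≤ ε₀/2`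
and `T = 2E/ε₀ + 1` this is absurd.  Hence every cap function of a witness obeys `G(ν) ≥ ε₀/ν`
eventually: the second child of the seam split is intrinsically a FIXED-`ν` statement whose
constant blows up as `ν → 0`, and carries no `ν`-uniform content. [folklore] -/
theorem not_uniformGalerkinTrap_uniformCap :
    ¬ ∃ (m : ℕ) (f : UnitAddTorus (Fin 3) → EuclideanSpace ℝ (Fin 3)),
      (IsSmooth f ∧ IsDivFree f ∧ ∀ k : Fin 3 → ℤ, ((m : ℕ) : ℝ) ^ 2 < freqNormSq k →
        mFourierCoeff (EuclideanSpace.complexify ∘ f) k = 0) ∧ HasZeroMean f ∧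
      ∃ (E ε₀ ν₀ : ℝ) (G : ℝ≥0), 0 < ε₀ ∧ 0 < ν₀ ∧ ∀ ν : ℝ, 0 < ν → ν ≤ ν₀ → ∃ N₀ : ℕ,
        ∀ N : ℕ, N₀ ≤ N → ∃ U : ℝ → UnitAddTorus (Fin 3) → EuclideanSpace ℝ (Fin 3),
          Torus.IsGalerkinTrajectory ν f N U ∧
            ∀ t : ℝ, 0 ≤ t → kineticEnergy (U t) ≤ E ∧ ε₀ ≤ ∫ x, ⟪f x, U t x⟫_ℝ ∧
              eGradNormSq (U t) ≤ (G : ℝ≥0∞) := by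
  rintro ⟨m, f, hf, -, E, ε₀, ν₀, G, hε₀, hν₀, h⟩
  have hG1 : 0 < (G : ℝ) + 1 := by positivity
  -- a viscosity below both `ν₀` and `ε₀ / (2(G+1))`
  set ν : ℝ := min ν₀ (ε₀ / (2 * ((G : ℝ) + 1))) with hν
  have hνpos : 0 < ν := lt_min hν₀ (by positivity)
  have hνle : ν ≤ ν₀ := min_le_left _ _
  have hνG : ν * (G : ℝ) ≤ ε₀ / 2 := by
    have h1 : ν ≤ ε₀ / (2 * ((G : ℝ) + 1)) := min_le_right _ _
    have h2 : ν * (G : ℝ) ≤ ν * ((G : ℝ) + 1) := by nlinarith [hνpos.le, G.coe_nonneg]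
    have h3 : ν * ((G : ℝ) + 1) ≤ ε₀ / (2 * ((G : ℝ) + 1)) * ((G : ℝ) + 1) :=
      mul_le_mul_of_nonneg_right h1 hG1.le
    have h4 : ε₀ / (2 * ((G : ℝ) + 1)) * ((G : ℝ) + 1) = ε₀ / 2 := by
      field_simp
    linarith
  obtain ⟨N₀, hN⟩ := h ν hνpos hνle
  obtain ⟨U, hU, htrap⟩ := hN N₀ le_rfl
  have hE : 0 ≤ E := (Torus.kineticEnergy_nonneg _).trans (htrap 0 le_rfl).1
  set T : ℝ := 2 * E / ε₀ + 1 with hT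
  have hTpos : 0 < T := by positivity
  -- mean dissipation floor from the work floor
  have hfloor := dissipation_floor_of_trapped hf.1.continuous hU
    (fun t ht => ⟨(htrap t ht).1, (htrap t ht).2.1⟩) hTpos.le
  -- dissipation ceiling from the cap
  have hcapInt : (∫⁻ τ in Ioo 0 T, eGradNormSq (U τ)) ≤ (G : ℝ≥0∞) * ENNReal.ofReal T := by
    calc (∫⁻ τ in Ioo 0 T, eGradNormSq (U τ)) ≤ ∫⁻ _ in Ioo 0 T, (G : ℝ≥0∞) :=
          setLIntegral_mono measurable_const fun τ hτ => (htrap τ hτ.1.le).2.2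
      _ = (G : ℝ≥0∞) * ENNReal.ofReal T := by
          rw [setLIntegral_const, Real.volume_Ioo, sub_zero]
  have hreal : (∫⁻ τ in Ioo 0 T, eGradNormSq (U τ)).toReal ≤ (G : ℝ) * T := by
    have hfin : (G : ℝ≥0∞) * ENNReal.ofReal T ≠ ∞ :=
      ENNReal.mul_ne_top ENNReal.coe_ne_top ENNReal.ofReal_ne_top
    have := ENNReal.toReal_mono hfin hcapInt
    rwa [ENNReal.toReal_mul, ENNReal.coe_toReal, ENNReal.toReal_ofReal hTpos.le] at this
  have h1 : ε₀ * T - E ≤ ν * ((G : ℝ) * T) :=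
    hfloor.trans (mul_le_mul_of_nonneg_left hreal hνpos.le)
  have h2 : ν * ((G : ℝ) * T) ≤ ε₀ / 2 * T := by
    have := mul_le_mul_of_nonneg_right hνG hTpos.le
    calc ν * ((G : ℝ) * T) = ν * (G : ℝ) * T := by ring
      _ ≤ ε₀ / 2 * T := this
  have h4 : ε₀ / 2 * T = E + ε₀ / 2 := by
    rw [hT]; field_simp
  nlinarith


/-! ## §4 Registered sub-goal form (one-line signature, for `--supports` landing) -/

/-- **Registered sub-goal `uniformGalerkinTrap_of_seamSplit`** — the seam glue of §1 restated with
its two hypotheses as a single one-line implication `UniformWorkFloorTrap → LoudOrbitsEventuallyCapped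
→ UniformGalerkinTrap` (the second arrow's antecedent is item stmt-AnomalousDissipation-17126 verbatim),
so that the crux item records it as a landed sub-goal; proof = `UniformGalerkinTrap_of_subs`. [folklore] -/
theorem uniformGalerkinTrap_of_seamSplit : UniformWorkFloorTrap → (∀ ν : ℝ, 0 < ν → ∀ (m : ℕ) (f : UnitAddTorus (Fin 3) → EuclideanSpace ℝ (Fin 3)), (IsSmooth f ∧ IsDivFree f ∧ ∀ k : Fin 3 → ℤ, ((m : ℕ) : ℝ) ^ 2 < freqNormSq k → mFourierCoeff (EuclideanSpace.complexify ∘ f) k = 0) → HasZeroMean f → ∀ E ε₀ : ℝ, 0 < ε₀ → ∃ (G : ℝ≥0) (N₁ : ℕ), ∀ N : ℕ, N₁ ≤ N → ∀ U : ℝ → UnitAddTorus (Fin 3) → EuclideanSpace ℝ (Fin 3), (ContinuousOn (stLift U) (Ici 0 ×ˢ univ) ∧ (∀ t : ℝ, 0 ≤ t → (IsSmooth (U t) ∧ IsDivFree (U t) ∧ ∀ k : Fin 3 → ℤ, ((N : ℕ) : ℝ) ^ 2 < freqNormSq k → mFourierCoeff (EuclideanSpace.complexify ∘ (U t)) k =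 0) ∧ IsWeaklyDivFree (U t)) ∧ (∀ a : UnitAddTorus (Fin 3) → EuclideanSpace ℝ (Fin 3), (IsSmooth a ∧ IsDivFree a ∧ ∀ k : Fin 3 → ℤ, ((N : ℕ) : ℝ) ^ 2 < freqNormSq k → mFourierCoeff (EuclideanSpace.complexify ∘ a) k = 0) → ∀ s t : ℝ, 0 ≤ s → s ≤ t → (∫ x, ⟪U t x, a x⟫_ℝ) - ∫ x, ⟪U s x, a x⟫_ℝ = ∫ τ in s..t, ∫ x, (⟪U τ x, convect (U τ) a x⟫_ℝ + ν * ⟪U τ x, laplacian a x⟫_ℝ + ⟪f x, a x⟫_ℝ)) ∧ (∀ s t : ℝ, 0 ≤ s → s ≤ t → kineticEnergy (U t) + ν * (∫⁻ τ in Ioo s t, eGradNormSq (U τ)).toReal = kineticEnergy (U s) + ∫ τ in s..t, ∫ x, ⟪f x, U τ x⟫_ℝ)) → (∀ t : ℝ, 0 ≤ t → kineticEnergy (U t) ≤ E ∧ ε₀ ≤ ∫ x, ⟪f x, U t x⟫_ℝ) → ∃ τ : ℝ, 0 ≤ τ ∧ ∀ t : ℝ, τ ≤ t → eGradNormSq (U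 t) ≤ (G : ℝ≥0∞)) → UniformGalerkinTrap :=
  fun h₁ h₂ => UniformGalerkinTrap_of_subs h₁ h₂

end Summit.AnomalousDissipation.AnomalousDissipation.Theorems.UniformGalerkinTrap

end
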